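import Summits.KontsevichZagierPeriods.KontsevichZagierPeriods.Theorems.RootDecompQuadraticDescentDarkPairsEleven
import Literature.NumberTheory.Transcendental.KZCubeRationalMoves
import Literature.NumberTheory.Transcendental.KZLogCalculusProofs
import Literature.NumberTheory.Transcendental.KZFibreMapMove
import Literature.NumberTheory.Transcendental.KZSemialgebraicComplex
import HarnessLib

/-!
# DARK census pair #10 `[□²,1/(1−x+y+x²−y²)] ≡ 2·[□²,1/(1+y+2xy+y²)]` DECIDED in `KZ.relations` by rules 1+2 (route `RootDecompQuadraticDescent`, instance of crux stmt-KontsevichZagierPeriods-28994 `DescentTwoQ` / stmt-4280 `KZDimTwo`) · part 1/6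

Cell `decomp-kz`, lens 6 (decomp-kz-lens-6 g8e): `pair10` — the golden-ratio dilogarithm pair of the weight-2 box census, decided with ℚ-data only (no power map, no Landen, no irrational cut); packaged `goldenPair_descentTwoQ_instance` (∀ R ⊇ relations) and `goldenPair_of_kzDimTwo` BY NAME over the born `KZDimTwo`; imports the LANDED `…DarkPairsEleven` reflection kit.  After this, the weight-2 box census has ONE open row (#18).

Source: `HOME/decomp-kz-lens-6/g8/GoldenPair10.lean` sha256 3ad60a9384e30dab (1472 l; critic decomp-kz-crit-1 g2 CLEARED/kernel-confirmed 2026-08-30T10:32:33Z, std axioms), split into 6 modules by the landing seat decomp-kz-census-1 g7 (contexts re-opened per part; generic docstrings added where the source had none; the route file is imported only by the last part).  No `sorry`; standard axioms.  References: [cite: KontsevichZagier2001, §1.2].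
-/

noncomputable section

open MeasureTheory Set MvPolynomial

namespace Summit.KontsevichZagierPeriods.RootDecompQuadraticDescent.GoldenPair

open Literature.NumberTheory.Transcendental
open Literature.NumberTheory.Transcendental.KZ
open Literature.ModelTheory.ExponentialFields (IsSemialgebraic continuous_aeval_real)
open Summit.KontsevichZagierPeriods.RootDecompQuadraticDescent.DarkPairs (rel_reflect_rep rel_double
  update_one_apply_zero one_div_eq_mul_one_div)

/-! ## §1 Small `Fin` bookkeeping and intervals (verbatim from `ZetaTwoPairs.lean`) -/
/-- `snoc2_zero`: auxiliary theorem of the lens-6 g8e development GoldenPair10 (census pair #10; instances of 28994/4280) — see the module docstring; verbatim from the lens file. -/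
@[simp] private theorem snoc2_zero (x : Fin 1 → ℝ) (t : ℝ) : (Fin.snoc x t : Fin 2 → ℝ) 0 = x 0 := rfl
/-- `snoc2_one`: auxiliary theorem of the lens-6 g8e development GoldenPair10 (census pair #10; instances of 28994/4280) — see the module docstring; verbatim from the lens file. -/
@[simp] private theorem snoc2_one (x : Fin 1 → ℝ) (t : ℝ) : (Fin.snoc x t : Fin 2 → ℝ) 1 = t := rfl
/-- `init2_zero`: auxiliary theorem of the lens-6 g8e development GoldenPair10 (census pair #10; instances of 28994/4280) — see the module docstring; verbatim from the lens file. -/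
@[simp] private theorem init2_zero (z : Fin 2 → ℝ) : Fin.init z 0 = z 0 := rfl
/-- `last_one_eq`: auxiliary theorem of the lens-6 g8e development GoldenPair10 (census pair #10; instances of 28994/4280) — see the module docstring; verbatim from the lens file. -/
private theorem last_one_eq : (Fin.last 1 : Fin 2) = 1 := rfl

/-- A regular rational function gives a KZ-rational representation. [folklore] -/
private theorem isRational_rep {M : ℕ} (T : RFun M) : T.rep.IsRational :=
  ⟨T.num, T.den, T.den_ne, fun _ _ => rfl⟩

/-- The interval `[a, b]` as a subset of `ℝ¹`. -/
def ivl (a b : ℚ) : Set (Fin 1 → ℝ) := {y | (a : ℝ) ≤ y 0 ∧ y 0 ≤ b}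

/-- `mem_ivl`: auxiliary theorem of the lens-6 g8e development GoldenPair10 (census pair #10; instances of 28994/4280) — see the module docstring; verbatim from the lens file. -/
theorem mem_ivl {a b : ℚ} {y : Fin 1 → ℝ} : y ∈ ivl a b ↔ (a : ℝ) ≤ y 0 ∧ y 0 ≤ b := Iff.rfl

/-- `I01`: auxiliary theorem of the lens-6 g8e development GoldenPair10 (census pair #10; instances of 28994/4280) — see the module docstring; verbatim from the lens file. -/
theorem I01 {y : Fin 1 → ℝ} (hy : y ∈ ivl 0 1) : y 0 ∈ Icc (0 : ℝ) 1 := by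
  simpa [mem_ivl] using hy

/-- `isSemialgebraic_ivl`: auxiliary theorem of the lens-6 g8e development GoldenPair10 (census pair #10; instances of 28994/4280) — see the module docstring; verbatim from the lens file. -/
theorem isSemialgebraic_ivl (a b : ℚ) : IsSemialgebraic ℚ (ivl a b) := by
  have h1 := Literature.ModelTheory.ExponentialFields.isSemialgebraic_setOf_eval_le (k := ℚ) (R := ℝ)
    (C a : MvPolynomial (Fin 1) ℚ) (X 0)
  have h2 := Literature.ModelTheory.ExponentialFields.isSemialgebraic_setOf_eval_le (k := ℚ) (R := ℝ)
    (X 0 : MvPolynomial (Fin 1) ℚ) (C b)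
  have h := h1.inter h2
  simp only [MvPolynomial.aeval_C, MvPolynomial.aeval_X, eq_ratCast] at h
  have hset : ivl a b = {y : Fin 1 → ℝ | (a : ℝ) ≤ y 0} ∩ {y | y 0 ≤ (b : ℝ)} := by
    ext y; simp [ivl]
  rw [hset]
  exact h

/-! ## §2 Edges, sub-graph domains, bounded band representations (verbatim from `ZetaTwoPairs.lean`) -/

/-- A `ℚ`-semialgebraic continuous NONNEGATIVE edge function `σ = f(t)` over `[0,1]`. -/
structure Edge where
  f : ℝ → ℝ
  sa : IsSemialgebraicFunOn ℚ (ivl 0 1) (fun y => f (y 0))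
  nonneg : ∀ t ∈ Icc (0 : ℝ) 1, 0 ≤ f t
  cont : ContinuousOn f (Icc (0 : ℝ) 1)

/-- `Edge.exists_bound`: auxiliary theorem of the lens-6 g8e development GoldenPair10 (census pair #10; instances of 28994/4280) — see the module docstring; verbatim from the lens file. -/
private theorem Edge.exists_bound (E : Edge) : ∃ M, ∀ t ∈ Icc (0 : ℝ) 1, E.f t ≤ M := by
  obtain ⟨C, hC⟩ := isCompact_Icc.exists_bound_of_continuousOn E.cont
  exact ⟨C, fun t ht => (le_abs_self _).trans (by simpa using hC t ht)⟩

/-- An edge given on `[0,1]` by a quotient of polynomials. -/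
def mkEdge (f : ℝ → ℝ) (P Q : MvPolynomial (Fin 1) ℚ) (hQ : ∀ y ∈ ivl 0 1, aeval y Q ≠ 0)
    (hPQ : ∀ y ∈ ivl 0 1, aeval y P / aeval y Q = f (y 0)) (h0 : ∀ t ∈ Icc (0 : ℝ) 1, 0 ≤ f t)
    (hc : ContinuousOn f (Icc (0 : ℝ) 1)) : Edge :=
  ⟨f, (isSemialgebraicFunOn_aeval_div_aeval (isSemialgebraic_ivl 0 1) P Q hQ).congr hPQ, h0, hc⟩

/-- `mkEdge_f`: auxiliary theorem of the lens-6 g8e development GoldenPair10 (census pair #10; instances of 28994/4280) — see the module docstring; verbatim from the lens file. -/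
@[simp] private theorem mkEdge_f (f : ℝ → ℝ) (P Q hQ hPQ h0 hc) : (mkEdge f P Q hQ hPQ h0 hc).f = f := rfl

/-- The sub-graph domain `{(t, σ) : 0 ≤ t ≤ 1, L(t) ≤ σ ≤ U(t)}`. -/
def sbDom (L U : Edge) : Set (Fin 2 → ℝ) :=
  KZlog.band (ivl 0 1) (fun y => L.f (y 0)) (fun y => U.f (y 0))

/-- `mem_sbDom`: auxiliary theorem of the lens-6 g8e development GoldenPair10 (census pair #10; instances of 28994/4280) — see the module docstring; verbatim from the lens file. -/
theorem mem_sbDom {L U : Edge} {z : Fin 2 → ℝ} :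
    z ∈ sbDom L U ↔ ((0 : ℝ) ≤ z 0 ∧ z 0 ≤ 1) ∧ L.f (z 0) ≤ z 1 ∧ z 1 ≤ U.f (z 0) := by
  show (Fin.init z ∈ ivl 0 1 ∧ L.f (Fin.init z 0) ≤ z (Fin.last 1) ∧
    z (Fin.last 1) ≤ U.f (Fin.init z 0)) ↔ _
  rw [mem_ivl]
  simp only [init2_zero, last_one_eq, Rat.cast_zero, Rat.cast_one]

/-- `isSemialgebraic_sbDom`: auxiliary theorem of the lens-6 g8e development GoldenPair10 (census pair #10; instances of 28994/4280) — see the module docstring; verbatim from the lens file. -/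
theorem isSemialgebraic_sbDom (L U : Edge) : IsSemialgebraic ℚ (sbDom L U) :=
  KZlog.isSemialgebraic_band L.sa U.sa

/-- `sbDom_subset_Icc`: auxiliary theorem of the lens-6 g8e development GoldenPair10 (census pair #10; instances of 28994/4280) — see the module docstring; verbatim from the lens file. -/
theorem sbDom_subset_Icc {L U : Edge} {M : ℝ} (hM : ∀ t ∈ Icc (0 : ℝ) 1, U.f t ≤ M) :
    sbDom L U ⊆ Icc ![(0 : ℝ), 0] ![(1 : ℝ), M] := by
  intro z hz
  rcases mem_sbDom.1 hz with ⟨⟨h1, h2⟩, h3, h4⟩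
  have h5 : 0 ≤ z 1 := (L.nonneg _ ⟨h1, h2⟩).trans h3
  refine ⟨fun i => ?_, fun i => ?_⟩ <;> fin_cases i
  · simpa using h1
  · simpa using h5
  · simpa using h2
  · simpa using h4.trans (hM _ ⟨h1, h2⟩)

/-- `volume_sbDom_lt_top`: auxiliary theorem of the lens-6 g8e development GoldenPair10 (census pair #10; instances of 28994/4280) — see the module docstring; verbatim from the lens file. -/
private theorem volume_sbDom_lt_top (L U : Edge) : volume (sbDom L U) < ⊤ := by
  obtain ⟨M, hM⟩ := U.exists_bound
  exact (measure_mono (sbDom_subset_Icc (L := L) hM)).trans_lt measure_Icc_lt_top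

/-- The edges `0`, `1`, `t`. -/
def zeroE : Edge := mkEdge (fun _ => 0) 0 1 (fun y _ => by simp) (fun y _ => by simp)
  (fun _ _ => le_rfl) continuousOn_const
/-- `oneE`: auxiliary def of the lens-6 g8e development GoldenPair10 (census pair #10; instances of 28994/4280) — see the module docstring; verbatim from the lens file. -/
def oneE : Edge := mkEdge (fun _ => 1) 1 1 (fun y _ => by simp) (fun y _ => by simp)
  (fun _ _ => zero_le_one) continuousOn_const
/-- `idE`: auxiliary def of the lens-6 g8e development GoldenPair10 (census pair #10; instances of 28994/4280) — see the module docstring; verbatim from the lens file. -/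
def idE : Edge := mkEdge (fun t => t) (X 0) 1 (fun y _ => by simp) (fun y _ => by simp)
  (fun _ ht => ht.1) continuousOn_id

/-- `zeroE_f`: auxiliary theorem of the lens-6 g8e development GoldenPair10 (census pair #10; instances of 28994/4280) — see the module docstring; verbatim from the lens file. -/
@[simp] theorem zeroE_f (t : ℝ) : zeroE.f t = 0 := rfl
/-- `oneE_f`: auxiliary theorem of the lens-6 g8e development GoldenPair10 (census pair #10; instances of 28994/4280) — see the module docstring; verbatim from the lens file. -/
@[simp] theorem oneE_f (t : ℝ) : oneE.f t = 1 := rfl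
/-- `idE_f`: auxiliary theorem of the lens-6 g8e development GoldenPair10 (census pair #10; instances of 28994/4280) — see the module docstring; verbatim from the lens file. -/
@[simp] private theorem idE_f (t : ℝ) : idE.f t = t := rfl

/-- `abs_div_le_of`: auxiliary theorem of the lens-6 g8e development GoldenPair10 (census pair #10; instances of 28994/4280) — see the module docstring; verbatim from the lens file. -/
private theorem abs_div_le_of {N D B : ℝ} (hN : |N| ≤ B) (hD : 1 ≤ D) : |N / D| ≤ B := by
  rw [abs_div, abs_of_pos (lt_of_lt_of_le one_pos hD)]
  exact (div_le_self (abs_nonneg N) hD).trans hN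

/-- A band representation on `sbDom L U` with a given bounded continuous semialgebraic integrand. -/
def BR (L U : Edge) (f : (Fin 2 → ℝ) → ℝ) (hf : IsSemialgebraicFunOn ℚ (sbDom L U) f)
    (hfc : ContinuousOn f (sbDom L U)) (B : ℝ) (hB : ∀ z ∈ sbDom L U, |f z| ≤ B) :
    KZ.IntegralRep 2 where
  domain := sbDom L U
  integrand := f
  isSemialgebraic_domain := isSemialgebraic_sbDom L U
  isSemialgebraicFunOn_integrand := hf
  integrableOn := by
    have hD := isSemialgebraic_sbDom L U
    refine IntegrableOn.of_bound (volume_sbDom_lt_top L U)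
      (hfc.aestronglyMeasurable (IsSemialgebraic.measurableSet_holds hD)) B ?_
    exact (ae_restrict_iff' (IsSemialgebraic.measurableSet_holds hD)).2 (ae_of_all _ fun z hz => by
      rw [Real.norm_eq_abs]; exact hB z hz)

/-- `BR_domain`: auxiliary theorem of the lens-6 g8e development GoldenPair10 (census pair #10; instances of 28994/4280) — see the module docstring; verbatim from the lens file. -/
@[simp] private theorem BR_domain (L U : Edge) (f hf hfc B hB) : (BR L U f hf hfc B hB).domain = sbDom L U := rfl
/-- `BR_integrand`: auxiliary theorem of the lens-6 g8e development GoldenPair10 (census pair #10; instances of 28994/4280) — see the module docstring; verbatim from the lens file. -/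
@[simp] private theorem BR_integrand (L U : Edge) (f hf hfc B hB) : (BR L U f hf hfc B hB).integrand = f := rfl

/-- The edge `1 + g`. -/
def Edge.onePlus (g : Edge) : Edge :=
  ⟨fun t => 1 + g.f t,
    (IsSemialgebraicFunOn.add_holds (isSemialgebraicFunOn_ratCast (isSemialgebraic_ivl 0 1) 1) g.sa).congr
      fun y _ => by simp,
    fun t ht => by linarith [g.nonneg t ht], continuousOn_const.add g.cont⟩

/-- `Edge.onePlus_f`: auxiliary theorem of the lens-6 g8e development GoldenPair10 (census pair #10; instances of 28994/4280) — see the module docstring; verbatim from the lens file. -/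
@[simp] theorem Edge.onePlus_f (g : Edge) (t : ℝ) : g.onePlus.f t = 1 + g.f t := rfl

/-- `z0_mem`: auxiliary theorem of the lens-6 g8e development GoldenPair10 (census pair #10; instances of 28994/4280) — see the module docstring; verbatim from the lens file. -/
private theorem z0_mem {L U : Edge} {z : Fin 2 → ℝ} (hz : z ∈ sbDom L U) : z 0 ∈ Icc (0 : ℝ) 1 :=
  (mem_sbDom.1 hz).1

/-- `RA = [ {0 ≤ t ≤ 1, 0 ≤ τ ≤ gp(t)}, c·tʲ dτ dt/(1 + tʲ⁺¹ τ) ]` (after the fibre scaling). -/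

theorem cube_eq_band : cube 2 = KZlog.band (ivl 0 1) (fun _ => (0 : ℝ)) fun _ => 1 := by
  ext z
  rw [KZlog.mem_band, last_one_eq, mem_ivl, mem_cube, Fin.forall_fin_two]
  simp only [init2_zero, Rat.cast_zero, Rat.cast_one]

/-- `cube_eq_sbDom`: auxiliary theorem of the lens-6 g8e development GoldenPair10 (census pair #10; instances of 28994/4280) — see the module docstring; verbatim from the lens file. -/
theorem cube_eq_sbDom : cube 2 = sbDom zeroE oneE := by
  rw [cube_eq_band]; rfl

/-- `rel_trans`: auxiliary theorem of the lens-6 g8e development GoldenPair10 (census pair #10; instances of 28994/4280) — see the module docstring; verbatim from the lens file. -/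
private theorem rel_trans {a b c : KZ.FormalRep} (h₁ : a - b ∈ KZ.relations) (h₂ : b - c ∈ KZ.relations) :
    a - c ∈ KZ.relations := by
  have h := add_mem h₁ h₂
  rwa [sub_add_sub_cancel] at h

/-- `rel_symm`: auxiliary theorem of the lens-6 g8e development GoldenPair10 (census pair #10; instances of 28994/4280) — see the module docstring; verbatim from the lens file. -/
private theorem rel_symm {a b : KZ.FormalRep} (h : a - b ∈ KZ.relations) : b - a ∈ KZ.relations := by
  have h' := neg_mem h
  rwa [neg_sub] at h'

/-! ## §3 Generic moves: fibre translation, base substitution, vertical pieces (from `SerretPair33.lean`) -/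

/-- Generic fibre translation `s = 1 + σ` (verbatim from `ZetaTwoPairs.lean`). -/
theorem rel_shift (g : Edge) (R R' : KZ.IntegralRep 2) (hR : R.domain = sbDom zeroE g)
    (hR' : R'.domain = sbDom oneE g.onePlus)
    (hint : ∀ z ∈ sbDom zeroE g, R.integrand z = R'.integrand (Fin.snoc (Fin.init z) (1 + z 1))) :
    KZ.of R - KZ.of R' ∈ KZ.relations := by
  have hB : IsSemialgebraic ℚ R.domain := R.isSemialgebraic_domain
  refine of_sub_of_mem_relations_of_fibreMap (G := ivl 0 1) (a := fun y => zeroE.f (y 0))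
    (b := fun y => g.f (y 0)) (a' := fun y => oneE.f (y 0)) (b' := fun y => g.onePlus.f (y 0))
    (fun z => 1 + z 1) (fun _ => (1 : ℝ)) R R' hR hR' (fun y hy => ?_) ?_ ?_ ?_ ?_ ?_ ?_ ?_
  · simpa using g.nonneg _ (I01 hy)
  · have h1 : IsSemialgebraicFunOn ℚ R.domain (fun z : Fin 2 → ℝ => z 1) := by
      simpa using isSemialgebraicFunOn_aeval hB (X 1 : MvPolynomial (Fin 2) ℚ)
    have hone : IsSemialgebraicFunOn ℚ R.domain (fun _ : Fin 2 → ℝ => (1 : ℝ)) := by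
      simpa using isSemialgebraicFunOn_ratCast hB 1
    exact (IsSemialgebraicFunOn.add_holds hone h1).congr fun z _ => by simp only [Pi.add_apply]
  · intro z _; fun_prop
  · intro z _
    show HasDerivAt (fun t => 1 + (Fin.snoc (Fin.init z) t : Fin 2 → ℝ) 1) 1 (z 1)
    simp only [snoc2_one]
    exact (hasDerivAt_id' (z 1)).const_add 1
  · intro z _; exact one_pos
  · intro y _
    show 1 + (Fin.snoc y (zeroE.f (y 0)) : Fin 2 → ℝ) 1 = oneE.f (y 0)
    simp
  · intro y _
    show 1 + (Fin.snoc y (g.f (y 0)) : Fin 2 → ℝ) 1 = g.onePlus.f (y 0)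
    simp
  · intro z hz
    rw [hint z (by rw [← hR]; exact hz), mul_one]

/-- Injectivity and image of an interval under a map with positive derivative in the interior. -/
private theorem injOn_image_of_deriv_pos' {κ κd : ℝ → ℝ} {a b : ℝ} (hab : a ≤ b)
    (hκd : ∀ t ∈ Icc a b, HasDerivAt κ (κd t) t) (hpos : ∀ t ∈ Ioo a b, 0 < κd t) :
    InjOn κ (Icc a b) ∧ κ '' Icc a b = Icc (κ a) (κ b) := by
  have hc : ContinuousOn κ (Icc a b) := fun t ht => (hκd t ht).continuousAt.continuousWithinAt
  have hm : StrictMonoOn κ (Icc a b) := strictMonoOn_of_deriv_pos (convex_Icc a b) hc fun t ht => by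
    rw [interior_Icc] at ht
    rw [(hκd t (Ioo_subset_Icc_self ht)).deriv]
    exact hpos t ht
  refine ⟨hm.injOn, Subset.antisymm ?_ (intermediate_value_Icc hab hc)⟩
  rintro _ ⟨t, ht, rfl⟩
  exact ⟨hm.monotoneOn (left_mem_Icc.2 hab) ht ht.1, hm.monotoneOn ht (right_mem_Icc.2 hab) ht.2⟩

/-- … and with negative derivative in the interior (orientation reversed). -/
private theorem injOn_image_of_deriv_neg' {κ κd : ℝ → ℝ} {a b : ℝ} (hab : a ≤ b)
    (hκd : ∀ t ∈ Icc a b, HasDerivAt κ (κd t) t) (hneg : ∀ t ∈ Ioo a b, κd t < 0) :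
    InjOn κ (Icc a b) ∧ κ '' Icc a b = Icc (κ b) (κ a) := by
  have hc : ContinuousOn κ (Icc a b) := fun t ht => (hκd t ht).continuousAt.continuousWithinAt
  have hm : StrictAntiOn κ (Icc a b) := strictAntiOn_of_deriv_neg (convex_Icc a b) hc fun t ht => by
    rw [interior_Icc] at ht
    rw [(hκd t (Ioo_subset_Icc_self ht)).deriv]
    exact hneg t ht
  refine ⟨hm.injOn, Subset.antisymm ?_ (intermediate_value_Icc' hab hc)⟩
  rintro _ ⟨t, ht, rfl⟩
  exact ⟨hm.antitoneOn ht (right_mem_Icc.2 hab) ht.2, hm.antitoneOn (left_mem_Icc.2 hab) ht ht.1⟩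

/-- **(base map)** a base substitution `t' = κ(t)`, `κ = p/q ∈ ℚ(t)` injective on `[0,1]` with image
`[lo, hi]`, lifted to bands with lower edge `1` (rule 2, Literature `KZ.of_sub_of_mem_relations_covLift`);
the Jacobian is `|κ'(t)|`. -/
theorem rel_base (κ κd : ℝ → ℝ) (pκ qκ : MvPolynomial (Fin 1) ℚ)
    (hq : ∀ y ∈ ivl 0 1, aeval y qκ ≠ 0) (hκq : ∀ y ∈ ivl 0 1, aeval y pκ / aeval y qκ = κ (y 0))
    (hκd : ∀ t ∈ Icc (0 : ℝ) 1, HasDerivAt κ (κd t) t) (hinj : InjOn κ (Icc (0 : ℝ) 1)) (lo hi : ℚ)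
    (himg : κ '' Icc (0 : ℝ) 1 = Icc (lo : ℝ) hi) (v v' : (Fin 1 → ℝ) → ℝ)
    (hvv' : ∀ y ∈ ivl 0 1, v y = v' (fun _ => κ (y 0))) (R R' : KZ.IntegralRep 2)
    (hR : R.domain = KZlog.band (ivl 0 1) (fun _ => 1) v)
    (hR' : R'.domain = KZlog.band (ivl lo hi) (fun _ => 1) v')
    (hint : ∀ z ∈ R.domain, R.integrand z =
      R'.integrand (Fin.snoc (fun _ : Fin 1 => κ (z 0)) (z 1)) * |κd (z 0)|) :
    KZ.of R - KZ.of R' ∈ KZ.relations := by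
  have hσ := isSemialgebraic_ivl 0 1
  let Φ : (Fin 1 → ℝ) → (Fin 1 → ℝ) := fun y _ => κ (y 0)
  let Φ' : (Fin 1 → ℝ) → (Fin 1 → ℝ) →L[ℝ] (Fin 1 → ℝ) := fun y =>
    κd (y 0) • ContinuousLinearMap.id ℝ (Fin 1 → ℝ)
  have hdet : ∀ y, (Φ' y).det = κd (y 0) := fun y => by
    simp only [Φ', ContinuousLinearMap.det, ContinuousLinearMap.toLinearMap_smul,
      ContinuousLinearMap.coe_id, LinearMap.det_smul, LinearMap.det_id, Module.finrank_fin_fun,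
      pow_one, mul_one]
  have himage : Φ '' ivl 0 1 = ivl lo hi := by
    ext w
    constructor
    · rintro ⟨y, hy, rfl⟩
      have : κ (y 0) ∈ Icc (lo : ℝ) hi := by rw [← himg]; exact mem_image_of_mem κ (I01 hy)
      exact this
    · intro hw
      obtain ⟨t, ht, htw⟩ : w 0 ∈ κ '' Icc (0 : ℝ) 1 := by rw [himg]; exact hw
      refine ⟨fun _ => t, ?_, ?_⟩
      · show ((0 : ℚ) : ℝ) ≤ t ∧ t ≤ ((1 : ℚ) : ℝ); push_cast; exact ht
      · funext i
        rw [Fin.fin_one_eq_zero i]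
        exact htw
  refine KZ.of_sub_of_mem_relations_covLift (σ := ivl 0 1) (Φ := Φ) (Φ' := Φ')
    (v := v) (v' := v') ?_ ?_ ?_ (fun y hy => hvv' y hy) R R' hR (by rw [himage]; exact hR')
    fun z hz => ?_
  · exact (isSemialgebraicMapOn_iff_forall_holds hσ).mpr fun _ =>
      (isSemialgebraicFunOn_aeval_div_aeval hσ pκ qκ hq).congr fun y hy => by
        show aeval y pκ / aeval y qκ = κ (y 0)
        exact hκq y hy
  · intro y hy
    have h1 : HasFDerivAt (fun y : Fin 1 → ℝ => κ (y 0))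
        (κd (y 0) • ContinuousLinearMap.proj (R := ℝ) (φ := fun _ : Fin 1 => ℝ) 0) y :=
      (hκd _ (I01 hy)).comp_hasFDerivAt y (hasFDerivAt_apply 0 y)
    have h2 : HasFDerivAt Φ (ContinuousLinearMap.pi fun _ : Fin 1 =>
        κd (y 0) • ContinuousLinearMap.proj (R := ℝ) (φ := fun _ : Fin 1 => ℝ) 0) y :=
      hasFDerivAt_pi.2 fun _ => h1
    have h3 : (ContinuousLinearMap.pi fun _ : Fin 1 =>
        κd (y 0) • ContinuousLinearMap.proj (R := ℝ) (φ := fun _ : Fin 1 => ℝ) 0) = Φ' y := by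
      ext w i
      rw [Fin.fin_one_eq_zero i]
      simp [Φ']
    exact (h3 ▸ h2).hasFDerivWithinAt
  · intro y₁ hy₁ y₂ hy₂ h
    have h0 : κ (y₁ 0) = κ (y₂ 0) := congrFun h 0
    funext i
    rw [Fin.fin_one_eq_zero i]
    exact hinj (I01 hy₁) (I01 hy₂) h0
  · rw [hdet, hint z hz]
    rfl

/-- The line `{t = q}` in `ℝ²` is null. -/
private theorem volume_vline (q : ℝ) : volume {z : Fin 2 → ℝ | z 0 = q} = 0 :=
  measure_mono_null (fun _ hz => hz)
    (KZ.volume_setOf_init_mem_eq_zero (n := 1) (KZ.volume_setOf_last_eq_zero (n := 0) q))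

end Summit.KontsevichZagierPeriods.RootDecompQuadraticDescent.GoldenPair

end
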